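import Summits.QuantumFields.BalabanUV.T4Continuum.Support.GradedWellData
import Summits.QuantumFields.BalabanUV.T4Continuum.Support.RegionGaugeSliceTorus
import Literature.MathematicalPhysics.QuantumFieldTheory.Balaban1983to89.Beta.VectorPropagatorDict

/-!
# T⁴ programme, spine node NE2 (U1a), sub-row Δ1 — graded well, crew socket (GW-W1), file 1 of 4:
# THE UNIT-TORUS SLICE INEQUALITY ON THE PLAIN LEVEL TYPES AND ITS ORBIT FORM («unit gauge Poincaré»)

NE2 formalisation swarm `b2b-balaban-t4-ne2-formalise-*`, leaf 09 (gen 11), for the row-NE2 owner's socket **(GW-W1)** of RULINGS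
R47 (e) / R48 (c) / R49 (a) (journal 2026-08-21): `SliceCoercive (curlT L M k) (gradT L M k) (GOmGW …) (QsGWn …) (QvGW …) a c` with a
LEVEL-FREE `c`.  The graded data break translation invariance, so B5's Plancherel proof of (1.90) does not apply to the graded well
directly; the transfer of this lineage is: unit-torus W1 (this file) ⟹ unit gauge Poincaré (this file) ⟹ graded vector mass dominates
the unit mass (file 2) + graded mean correction (file 3) ⟹ graded gauge Poincaré ⟹ `OrthSliceCoercive` ⟹ (gen 8's abstract
`RegionGaugeSliceOrth.sliceCoercive_of_orthSlice`) `SliceCoercive` for the graded well (file 4).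

WHAT IS PRINTED.  [Balaban1984PropagatorsI] p. 29–30, (1.69)–(1.70): «⟨A, Δ_a A⟩ = ⟨A, ∂*∂A⟩ + ⟨A, ∂R∂*A⟩ + a⟨A, Q*QA⟩ … R = I − P …
The configuration ∂*A is orthogonal to constant functions and on such configurations the operator P is given by the formula
P = Δ⁻¹Q′*(Q′Δ⁻²Q′*)⁻¹Q′Δ⁻¹», and Prop. 1.1 (1.90) p. 33 (coercivity of `Δ_a`; tree kernel version `DirichletRegionTower.coercive_calDa`,
constant `γ_D = ((d+1)·Cst(d,a))⁻¹` ours).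

WHAT THIS FILE PROVES ([folklore] bookkeeping over landed modules; 0 sorry).  Leaf-07-g6's `RegionGaugeSliceTorus.sliceCoercive_top` states
the ⊤-witness of the slice inequality on the REGION types of `S = ⊤` (subtypes along an everywhere-true predicate); the graded well lives
on the PLAIN level-`k` torus types `Tor (fine n M)`, `Tor (fine n M) × Fin d`, `Tor M`, `Tor M × Fin d`.  So:
 * §1 the UNIT DATA on the plain level-`k` types (`n = L^k`): the owner's `curlT = 2^{−1/2}·Curl`, `gradT = ∂` (factor `n`) of `GradedWellData`,
   `Δ′ = DeltaPs = −Δ + a′Π′`, `G′ = Gps`, `Q′ = QsOp`, `Q = QvOp`, `∂₁ = GradOp M 1`; `QsOp_mul_conjTranspose'` (`Q′Q′ᴴ = n^{−d}·1`, re-derived from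
   `ScalarBlockPoincare.QsOp_apply_blockOf` to keep the import cone small), `lap_of_ker_unit`, **`sliceData_unit`** (the `avg_grad`
   field is B5's (1.55) `VectorPropagatorDict.QvOp_mul_GradOp` BY NAME);
 * §2 **`sliceCoercive_unit (ha : 0 < a) (ha′ : 0 < a′) : SliceCoercive (curlT L M k) (gradT L M k) (Gps n M a′) (QsOp n M) (QvOp n M) (a·n^d) (gamD d a)`**
   — leaf-07-g6's mechanism verbatim on plain types: `eq_G_QH_of_gaugeR_eq_zero` ⟹ `Δ(∂ᴴA′) ∈ range Q′ᴴ` ⟹ `PcT_mulVec_eq_self` ⟹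
   `re_form_DeltaA_of_PcT` ⟹ `coercive_calDa` + `calDa_eq_DeltaA`;
 * §3 the ORBIT FORM, abstract and instance: **`gaugePoincare_of_sliceCoercive`** (any `SliceData`: slice coercivity `c` ⟹ every field
   `A` has a gauge representative `A − Dμ`, `μ = gaugePart A ∈ N(Q′)`, with `c·nsq (A − Dμ) ≤ nsq (CA) + a·nsq (QA)` — leaf-07-g5's
   `slicePart`/`Cu_slicePart`/`Qv_slicePart`), and **`exists_unit_gauge`**: on the level-`k` torus every vector field is, up to a gauge
   transformation with ZERO UNIT-BLOCK MEANS, bounded by its curl and its unit block averages with B5's constant: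
   `∃ μ, Q′μ = 0 ∧ γ_D·nsq (A − ∂μ) ≤ nsq (curlT A) + a n^d·nsq (Q A)`.

HONEST FRAMING (T4-DAG p. 1).  Model level (`U = 1`, finite torus, one averaging scale in this file); [folklore]; `[cite:]` tags locate
SHAPES; at `S = ⊤` this is B5 (1.90) re-read on the slice (as in leaf-07-g6's file), NOT a region or graded estimate; (GW-W1) itself is
file 4; NE2 (U1a) NOT proved; spine PROVED 0/9 unchanged; NOT [B9] (3.16)/(3.23)–(3.27) as printed; NOT infinite volume / mass gap / Clay.
HONEST DEPENDENCY: continuum YM on T⁴ ⇐ BetaPertH ∧ nine spine estimates (0/9 proved); BetaPertH ⇐ (D1) ∧ (D4) ∧ CAP+tail; G-an2-4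
gates asym, D1 and NE2/3/4.  ABSOLUTE RULE kept: no `def … : Prop` fact, no cited hypothesis, zero `sorry`.
-/

noncomputable section

open scoped BigOperators ComplexConjugate Matrix Matrix.Norms.L2Operator
open Finset

namespace Summit.QuantumFields.BalabanUV.T4Continuum.GradedWellUnitSlice

open Literature.MathematicalPhysics.QuantumFieldTheory.Balaban1983to89.B5Prop11Plancherel (Tor fine)
open Literature.MathematicalPhysics.QuantumFieldTheory.Balaban1983to89.B5Prop11Lower (nsq nsq_nonneg)
open Literature.MathematicalPhysics.QuantumFieldTheory.Balaban1983to89.B5Prop11Inverse (calDa)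
open Literature.MathematicalPhysics.QuantumFieldTheory.Balaban1983to89.B5Action121 (LapS GradOp CurlOp GradOp_conjTranspose_mul_GradOp)
open Literature.MathematicalPhysics.QuantumFieldTheory.Balaban1983to89.B5Block118 (QsOp QvOp)
open Literature.MathematicalPhysics.QuantumFieldTheory.Balaban1983to89.B5Blocks16 (blockOf sum_blocks)
open Literature.MathematicalPhysics.QuantumFieldTheory.Balaban1983to89.B5Value126 (PcT)
open Literature.MathematicalPhysics.QuantumFieldTheory.Balaban1983to89.B5DivOrth (sum_GradOp_adjoint)
open Literature.MathematicalPhysics.QuantumFieldTheory.Balaban1983to89.B5DeltaA169 (DeltaA calDa_eq_DeltaA)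
open Literature.MathematicalPhysics.QuantumFieldTheory.Balaban1983to89.B5G183RateUnitTower (lev lev_neZero)
open Literature.MathematicalPhysics.QuantumFieldTheory.Balaban1983to89.Beta.VectorPropagatorDict (QvOp_mul_GradOp)
open Summit.QuantumFields.BalabanUV.T4Continuum
open Summit.QuantumFields.BalabanUV.T4Continuum.SubtypeCompression (Coercive)
open Summit.QuantumFields.BalabanUV.T4Continuum.ScalarBlockPoincare (PiS nsq_smul QsOp_apply_blockOf)
open Summit.QuantumFields.BalabanUV.T4Continuum.ScalarAveragedPropagator (DeltaPs Gps Gps_isHermitian DeltaPs_mul_Gps Gps_mul_DeltaPs)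
open Summit.QuantumFields.BalabanUV.T4Continuum.RegionGaugeProjection (gramK gaugeP gaugeR isUnit_det_gramK)
open Summit.QuantumFields.BalabanUV.T4Continuum.RegionGaugeSlice (SliceData SliceCoercive gaugePart slicePart Qs_gaugePart
  gaugeR_Dh_slicePart Cu_slicePart Qv_slicePart re_form_le_opNorm)
open Summit.QuantumFields.BalabanUV.T4Continuum.DirichletRegionTower (gamD gamD_pos coercive_calDa)
open Summit.QuantumFields.BalabanUV.T4Continuum.RegionGaugeSliceTorus (PcT_mulVec_eq_self eq_G_QH_of_gaugeR_eq_zero re_form_DeltaA_of_PcT)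
open Summit.QuantumFields.BalabanUV.T4Continuum.BalabanAveragedTowerUnit (one_le_lev')
open Summit.QuantumFields.BalabanUV.T4Continuum.GradedWellData (TorK curlT gradT curlT_mul_gradT)

variable {d : ℕ}

/-! ## §3a The orbit form, abstract -/

section Abstract

variable {m v w u uv : Type*} [Fintype m] [DecidableEq m] [Fintype v] [Fintype u] [DecidableEq u] [Fintype w] [Fintype uv]
variable {Cu : Matrix w v ℂ} {Dg : Matrix v m ℂ} {Dp G : Matrix m m ℂ} {Qs : Matrix u m ℂ} {Qv : Matrix uv v ℂ} {Dg₁ : Matrix uv u ℂ}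

/-- **THE ORBIT FORM OF SLICE COERCIVITY («gauge Poincaré»)**: under the structural identities `SliceData`, slice coercivity with constant
`c` gives, for EVERY field `A`, a gauge representative `A − Dμ` with `μ ∈ N(Q′)` (`μ = λ_A`, leaf-07-g5's gauge part) obeying
`c·‖A − Dμ‖² ≤ ‖CA‖² + a‖QA‖²`. [folklore] -/
theorem gaugePoincare_of_sliceCoercive (h : SliceData Cu Dg Dp G Qs Qv Dg₁) {a c : ℝ} (hS : SliceCoercive Cu Dg G Qs Qv a c)
    (A : v → ℂ) : ∃ mu : m → ℂ, Qs *ᵥ mu = 0 ∧ c * nsq (A - Dg *ᵥ mu) ≤ nsq (Cu *ᵥ A) + a * nsq (Qv *ᵥ A) := by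
  refine ⟨gaugePart Dg G Qs A, Qs_gaugePart h A, ?_⟩
  have key := hS (slicePart Dg G Qs A) (gaugeR_Dh_slicePart h A)
  rw [Cu_slicePart h A, Qv_slicePart h A] at key
  exact key

end Abstract

/-! ## §1 The unit data on the plain level types -/

section Unit

variable (L : ℕ) [NeZero L] (M : Fin d → ℕ) [hM : ∀ μ, NeZero (M μ)] (k : ℕ) (a a' : ℝ)

/-- `‖curlT B‖² = ½‖Curl B‖²`. [folklore] -/
theorem nsq_curlT_mulVec (B : TorK L M k × Fin d → ℂ) :
    nsq (curlT L M k *ᵥ B) = (1 / 2) * nsq (CurlOp (fine (lev L k) M) ((lev L k : ℕ) : ℂ) *ᵥ B) := by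
  rw [curlT, Matrix.smul_mulVec, nsq_smul, Complex.norm_real, Real.norm_of_nonneg (by positivity), inv_pow,
    Real.sq_sqrt (by norm_num : (0:ℝ) ≤ 2), one_div]

/-- `Q′Q′ᴴ = n^{−d}·1` (distinct blocks are disjoint, each with `n^d` sites; the tree's `LineAveragingPairingLaw.QsOp_mul_conjTranspose`,
re-derived here from `QsOp_apply_blockOf` to keep this file's import cone inside the graded-well cone). [cite: Balaban1984PropagatorsI, (1.14) p.19 (shape)] [folklore] -/
theorem QsOp_mul_conjTranspose' : QsOp (lev L k) M * (QsOp (lev L k) M)ᴴ = ((((lev L k : ℝ) ^ d)⁻¹ : ℝ) : ℂ) • (1 : Matrix (Tor M) (Tor M) ℂ) := by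
  set n := lev L k with hn0
  have hn : ((n : ℂ) ^ d) ≠ 0 := pow_ne_zero _ (by exact_mod_cast NeZero.ne n)
  ext y y'
  rw [Matrix.mul_apply, Matrix.smul_apply, smul_eq_mul]
  have e : ∀ x, QsOp n M y x * (QsOp n M)ᴴ x y'
      = if blockOf n M x = y then (if blockOf n M x = y' then 1 / (n : ℂ) ^ d * (1 / (n : ℂ) ^ d) else 0) else 0 := by
    intro x
    rw [Matrix.conjTranspose_apply, QsOp_apply_blockOf, QsOp_apply_blockOf]
    by_cases h1 : blockOf n M x = y
    · rw [if_pos h1, if_pos h1]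
      by_cases h2 : blockOf n M x = y'
      · rw [if_pos h2, if_pos h2, star_div₀, star_one, star_pow, Complex.star_def, Complex.conj_natCast]
      · rw [if_neg h2, if_neg h2, star_zero, mul_zero]
    · rw [if_neg h1, if_neg h1, zero_mul]
  rw [Finset.sum_congr rfl fun x _ => e x, sum_blocks n M]
  simp only [Literature.MathematicalPhysics.QuantumFieldTheory.Balaban1983to89.B5Blocks16.blockOf_bpt, Finset.sum_const,
    Finset.card_univ, Fintype.card_fun, Fintype.card_fin, smul_ite, smul_zero, Finset.sum_ite_eq', Finset.mem_univ, if_true,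
    nsmul_eq_mul, Matrix.one_apply]
  by_cases hy : y = y'
  · subst hy
    rw [if_pos rfl, if_pos rfl, mul_one]
    push_cast
    rw [hn0] at hn ⊢
    field_simp
  · rw [if_neg hy, if_neg hy, mul_zero]

/-- **on `N(Q′)` the averaged scalar operator is the Laplacian**: `Q′λ = 0 → Δ′λ = ∂ᴴ(∂λ)` (`Δ′ = −Δ + a′Π′`, `Π′ = n^d·Q′ᴴQ′`).
[cite: Balaban1984PropagatorsI, (1.69) p.29 (shape: Δ′_a)] [folklore] -/
theorem lap_of_ker_unit (lam : TorK L M k → ℂ) (h : QsOp (lev L k) M *ᵥ lam = 0) :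
    DeltaPs (lev L k) M a' *ᵥ lam = (gradT L M k)ᴴ *ᵥ (gradT L M k *ᵥ lam) := by
  unfold DeltaPs
  rw [Matrix.add_mulVec, Matrix.smul_mulVec, PiS, Matrix.smul_mulVec, ← Matrix.mulVec_mulVec, h, Matrix.mulVec_zero, smul_zero,
    smul_zero, add_zero, ← GradOp_conjTranspose_mul_GradOp, Matrix.mulVec_mulVec]

/-- `0 < ‖Δ′‖` (a coercive operator on a nonempty space). [folklore] -/
theorem opNorm_DeltaPs_pos (ha' : 0 < a') : 0 < ‖DeltaPs (lev L k) M a'‖ := by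
  set n := lev L k with hn0
  set v : Tor (fine n M) → ℂ := fun _ => 1 with hv
  obtain ⟨hγ, _⟩ := ScalarAveragedPropagator.gammaPs_pos (d := d) (a' := a')
  have hnsq : 0 < nsq v := by
    unfold nsq
    refine Finset.sum_pos (fun x _ => by simp [hv]) ⟨0, Finset.mem_univ _⟩
  have h1 := ScalarAveragedPropagator.re_form_DeltaPs_ge n M ha' v
  have hH := ScalarAveragedPropagator.DeltaPs_isHermitian n M a'
  have e : star (DeltaPs n M a' *ᵥ v) ⬝ᵥ v = star v ⬝ᵥ (DeltaPs n M a' *ᵥ v) := by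
    rw [Matrix.star_mulVec, hH.eq, ← Matrix.dotProduct_mulVec]
  have h2 : (star v ⬝ᵥ (DeltaPs n M a' *ᵥ v)).re ≤ ‖DeltaPs n M a'‖ * nsq v := by
    rw [← e]; exact re_form_le_opNorm _ v
  by_contra h
  push Not at h
  have h3 : ‖DeltaPs n M a'‖ = 0 := le_antisymm h (norm_nonneg _)
  rw [h3, zero_mul] at h2
  nlinarith

/-- **THE SLICE DATA OF THE UNIT TORUS** on the plain level types (the seven `U = 1` identities behind (3.26) at `S = ⊤`).
[cite: Balaban1984PropagatorsI, (1.55) p.27 («Q∂ = ∂₁Q′»); Balaban1985BackgroundPropagators, (3.21)–(3.26) pp.394–395 (shapes)] [folklore] -/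
theorem sliceData_unit (ha' : 0 < a') :
    SliceData (curlT L M k) (gradT L M k) (DeltaPs (lev L k) M a') (Gps (lev L k) M a') (QsOp (lev L k) M) (QvOp (lev L k) M)
      (GradOp M 1) where
  curl_grad := curlT_mul_gradT L M k
  avg_grad := QvOp_mul_GradOp (lev L k) M
  lap_of_ker := lap_of_ker_unit L M k a'
  herm := Gps_isHermitian (lev L k) M a'
  G_mul := Gps_mul_DeltaPs (lev L k) M ha'
  mul_G := DeltaPs_mul_Gps (lev L k) M ha'
  gram_unit := isUnit_det_gramK _ _ (Gps_isHermitian (lev L k) M a') (DeltaPs_mul_Gps (lev L k) M ha') (opNorm_DeltaPs_pos L M k a' ha')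
    (inv_pos.mpr (pow_pos (by exact_mod_cast Nat.pos_of_ne_zero (NeZero.ne (lev L k))) d)) (QsOp_mul_conjTranspose' L M k)

/-! ## §2 Slice coercivity of the unit torus on the plain level types -/

/-- **ON BAŁABAN's SLICE OF THE UNIT TORUS, B5's CO-PROJECTION FIXES THE DIVERGENCE**: `R(⊤)·∂ᴴA′ = 0 ⟹ P(∂ᴴA′) = ∂ᴴA′`
(`∂ᴴA′ = G′Q′ᴴμ` ⟹ `Δ′(∂ᴴA′) = Q′ᴴμ` ⟹ `Δ(∂ᴴA′) = Q′ᴴ(μ − a′n^d·Q′∂ᴴA′)` ⟹ leaf-07-g6's key torus lemma, `∂ᴴA′ ⊥ 1`).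
[cite: Balaban1984PropagatorsI, (1.70) p.30 (shape: the formula for P on ∂*A ⊥ 1)] [folklore] -/
theorem PcT_div_eq_self_of_gaugeR_eq_zero (ha' : 0 < a') (A' : TorK L M k × Fin d → ℂ)
    (hR : gaugeR (Gps (lev L k) M a') (QsOp (lev L k) M) *ᵥ ((gradT L M k)ᴴ *ᵥ A') = 0) :
    PcT (lev L k) M ((lev L k : ℕ) : ℂ) *ᵥ ((gradT L M k)ᴴ *ᵥ A') = (gradT L M k)ᴴ *ᵥ A' := by
  set n := lev L k with hn0
  set f := (gradT L M k)ᴴ *ᵥ A' with hf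
  set ν := (gramK (Gps n M a') (QsOp n M))⁻¹ *ᵥ (QsOp n M *ᵥ (Gps n M a' *ᵥ f)) with hν
  have e := eq_G_QH_of_gaugeR_eq_zero _ _ _ hR
  -- apply `Δ′` to `f = G′Q′ᴴν`
  have hD : DeltaPs n M a' *ᵥ f = (QsOp n M)ᴴ *ᵥ ν := by
    conv_lhs => rw [e]
    rw [Matrix.mulVec_mulVec, DeltaPs_mul_Gps n M ha', Matrix.one_mulVec]
  -- `Δf = Q′ᴴ(ν − a′n^d·Q′f)`
  unfold DeltaPs at hD
  rw [Matrix.add_mulVec, Matrix.smul_mulVec, PiS, Matrix.smul_mulVec, ← Matrix.mulVec_mulVec, smul_smul] at hD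
  have hL : LapS (fine n M) ((n : ℕ) : ℂ) *ᵥ f
      = (QsOp n M)ᴴ *ᵥ (ν - ((a' : ℂ) * (n : ℂ) ^ d) • (QsOp n M *ᵥ f)) := by
    rw [Matrix.mulVec_sub, Matrix.mulVec_smul, ← hD, add_sub_cancel_right]
  exact PcT_mulVec_eq_self n M (by exact_mod_cast NeZero.ne n) f (sum_GradOp_adjoint (fine n M) _ A') _ hL

/-- **THE UNIT-TORUS SLICE INEQUALITY ON THE PLAIN LEVEL TYPES**: for every `A′` with `R(⊤)·∂ᴴA′ = 0`,
`γ_D·‖A′‖² ≤ ‖curlT A′‖² + a n^d·‖QA′‖²`, `γ_D = ((d+1)·Cst(d,a))⁻¹`, uniformly in `n`, `M` (leaf-07-g6's ⊤-witness, same mechanism).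
[cite: Balaban1984PropagatorsI, Prop. 1.1 (1.90) p.33 (kernel version of the tree, read on the slice; constant ours)] [folklore] -/
theorem sliceCoercive_unit (ha : 0 < a) (ha' : 0 < a') :
    SliceCoercive (curlT L M k) (gradT L M k) (Gps (lev L k) M a') (QsOp (lev L k) M) (QvOp (lev L k) M)
      (a * ((lev L k : ℕ) : ℝ) ^ d) (gamD d a) := by
  intro A' hA'
  have hco := coercive_calDa M a ha (lev L k) (one_le_lev' L k) A'
  rw [calDa_eq_DeltaA (lev L k) (one_le_lev' L k) M a ha,
    re_form_DeltaA_of_PcT (lev L k) M a _ (PcT_div_eq_self_of_gaugeR_eq_zero L M k a' ha' A' hA')] at hco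
  rw [nsq_curlT_mulVec]
  exact hco

/-! ## §3b The orbit form, unit instance -/

/-- **UNIT GAUGE POINCARÉ ON THE LEVEL TORUS**: every vector field `A` on `Tor (fine (L^k) M) × Fin d` admits a scalar `μ` with ZERO UNIT-BLOCK
MEANS such that `γ_D·‖A − ∂μ‖² ≤ ‖curlT A‖² + a n^d·‖QA‖²` — uniformly in `n`, `M`. [cite: Balaban1984PropagatorsI, Prop. 1.1 (1.90) p.33 (kernel version, orbit form; constant ours)] [folklore] -/
theorem exists_unit_gauge (ha : 0 < a) (ha' : 0 < a') (A : TorK L M k × Fin d → ℂ) :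
    ∃ mu : TorK L M k → ℂ, QsOp (lev L k) M *ᵥ mu = 0 ∧
      gamD d a * nsq (A - gradT L M k *ᵥ mu) ≤ nsq (curlT L M k *ᵥ A) + a * ((lev L k : ℕ) : ℝ) ^ d * nsq (QvOp (lev L k) M *ᵥ A) :=
  gaugePoincare_of_sliceCoercive (sliceData_unit L M k a' ha') (sliceCoercive_unit L M k a a' ha ha') A

end Unit

end Summit.QuantumFields.BalabanUV.T4Continuum.GradedWellUnitSlice

end
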